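import Literature.Geometry.Lorentzian.KerrPeel
import HarnessLib

/-!
# The horizon leaf anchor over a boosted Kerr–Schild background

`KerrAnchor.horizonLeafAnchor_model`: for a chart `Φ` of ANY time-oriented `Spacetime 4` on a model
background `B` whose form, time and radius functions are those of the boosted Kerr–Schild background
with motion `(Λ, c)` (`M > 0`, any `a` — sub-extremality is not used) and whose chart domain lies in
`{r > r₊ − h}` (`0 < h < r₊`), there is `ε > 0` (`ε = 1/(16 K² A²)`, `K = ‖Λ‖`, `A = sup_{r = r₊} ‖V‖ + 1`)
such that: if `Φ` is injective on the late region `{t* ≥ τ₁}`, the pointwise deviation at late leaf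
points is `≤ ε`, `dΦ(ΛV)` is future-directed there, the leaf `N = {r = r₊}` is STRICTLY OUTWARD-CLOSED
FROM INSIDE after `τ₁` (no late point with `r < r₊` causally precedes a late point with
`r₊ ≤ r ≤ r₊ + h`) and RULED (every late point of `N` precedes points of `N` arbitrarily later), then at
every late point `w ∈ N` there is a rest-frame vector `v` with `v⁰ > 0`, `g(dΦ Λv, dΦ Λv) ≤ 0` and
`dr(v) ≥ 0` — the perturbed cone at `N` contains a future non-inward direction.

Proof (O'Neill 1983, Ch. 5 and Ch. 14, made quantitative): §2 the perturbed light cone over a boosted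
Kerr–Schild background — the error form of a perturbed boosted form (`perturbed_error_le`), CONE
CONTROL (`cone_control`: a future causal vector of a form `e`-close to `g_{M,a}(p)` in the half cone of
`V_p` has `v⁰ > 0`, `‖v‖ ≤ 2 v⁰`; reverse Cauchy–Schwarz with an error term, from the coercivity
`KerrPeel.kerr_self_ge`), NONDEGENERACY (`nondegenerate_of_perturbed`, via
`Minkowski.nondegenerate_of_spatial_pos`), compactness of the normalised directions; §3 the anchor:
continuity of the metric components in the chart at `w`, the tube argument
(`IsCompact.eventually_forall_of_forall_eventually`), the local diffeomorphism
(`Spacetime.isLocalDiffeomorphAt_of_metricInCoords_nondegenerate`), the lift of the germ of the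
ruling curve and the monotonicity of `t*` / strict decrease of `r` along it, contradiction with
strictness.  References: O'Neill 1983, Ch. 5 (Lemmas 5.26–5.30), Ch. 14 (Lemma 14.2, p. 402);
Kerr–Schild 1965; Visser arXiv:0706.0622, (32)–(35); Hawking–Ellis 1973, §6.2–6.4.

Provenance: decomp-fsc lens-3 g33 side file `HorizonLeafAnchor33.lean` ll. 367–871 (namespace
`KerrAnchor`, farm-checked there), re-homed verbatim on top of `KerrPeel` (the shared §1 helpers are
imported, not copied); the main proof is one ≈ 370-line tactic block and keeps its scoped heartbeat
budget (`maxHeartbeats 4000000`).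

NOT here: the route-side corollary for vacuum Cauchy developments (a Theses-side 4-liner), the collar
climb (`KerrPeelClimb`) and the slope field (`KerrSlope`).
-/

noncomputable section

open scoped Topology Manifold ContDiff ENNReal
open Filter Set Function

namespace Literature.Geometry.Lorentzian

namespace KerrAnchor

open Metric KerrPeel

-- typeclass search through nested operator types `E4 →L[ℝ] E4 →L[ℝ] ℝ` (as in `BoostedKerrCausalLegs`)
set_option maxSynthPendingDepth 3

variable {M a : ℝ} {x : E4}

/-! ### §2 The perturbed light cone over a boosted Kerr–Schild background: cone control, nondegeneracy -/

/-- **Error form of a perturbed boosted form.** If `‖m − g_B‖ ≤ η`, `g_B(Lv, Lw) = g(v, w)` and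
`‖Lv‖ ≤ K‖v‖`, then `|m(Lv, Lw) − g(v, w)| ≤ η K² ‖v‖ ‖w‖` (operator-norm bookkeeping for the closeness
norms of DHRT arXiv:2104.08222, §1). [cite: arXiv210408222] -/
theorem perturbed_error_le (m gB g : E4 →L[ℝ] E4 →L[ℝ] ℝ) (L : E4 ≃L[ℝ] E4)
    (hgB : ∀ v w : E4, gB (L v) (L w) = g v w) {η K : ℝ} (hη : ‖m - gB‖ ≤ η) (hK0 : 0 ≤ K)
    (hK : ∀ v : E4, ‖L v‖ ≤ K * ‖v‖) (v w : E4) :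
    |m (L v) (L w) - g v w| ≤ η * K ^ 2 * ‖v‖ * ‖w‖ := by
  rw [← hgB v w, show m (L v) (L w) - gB (L v) (L w) = (m - gB) (L v) (L w) from rfl]
  have hη0 : 0 ≤ η := (norm_nonneg _).trans hη
  calc |(m - gB) (L v) (L w)| ≤ ‖m - gB‖ * ‖L v‖ * ‖L w‖ := abs_apply₂_le _ _ _
    _ ≤ η * (K * ‖v‖) * (K * ‖w‖) :=
        mul_le_mul (mul_le_mul hη (hK v) (norm_nonneg _) hη0) (hK w) (norm_nonneg _)
          (mul_nonneg hη0 (mul_nonneg hK0 (norm_nonneg _)))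
    _ = η * K ^ 2 * ‖v‖ * ‖w‖ := by ring

/-- **Cone control.** Let `Q` be a form on rest-frame vectors with
`|Q(v, w) − g_{M,a}(p)(v, w)| ≤ e ‖v‖ ‖w‖`, `e ≤ 1/4`, `e ‖V_p‖ ≤ 1/8` (`V = −g♯dt*` the Kerr–Schild time
vector, `r(p) > 0`, `M ≥ 0`).  If `Q(v, v) ≤ 0` and `Q(V_p, v) < 0` then `v⁰ > 0` and `‖v‖ ≤ 2 v⁰`: the
`Q`-causal vectors in the half-cone of `V_p` have uniformly positive Kerr–Schild time component and bounded
slope (reverse Cauchy–Schwarz with an error term). O'Neill 1983, Ch. 5, Lemmas 5.26–5.30.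
[cite: ONeillSemiRiemannian1983, Ch. 5, Lemma 5.29] -/
theorem cone_control (hM : 0 ≤ M) {p : E4} (hp : 0 < Kerr.radius a p) {Q : E4 → E4 → ℝ} {e : ℝ}
    (he : e ≤ 1 / 4) (heV : e * ‖Kerr.timeVector M a p‖ ≤ 1 / 8)
    (hE : ∀ v w : E4, |Q v w - Kerr.bilin M a p v w| ≤ e * ‖v‖ * ‖w‖) {v : E4}
    (ha : Q v v ≤ 0) (hb : Q (Kerr.timeVector M a p) v < 0) : 0 < v 0 ∧ ‖v‖ ≤ 2 * v 0 := by
  have h1 := kerr_self_ge (a := a) hM p v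
  have h3 := (abs_le.1 (hE v v)).1
  have hn := norm_nonneg v
  have h4 : ‖v‖ ^ 2 ≤ 4 * v 0 ^ 2 := by nlinarith [mul_nonneg hn hn]
  have h5 : ‖v‖ ≤ 2 * |v 0| := by
    have h' : ‖v‖ ^ 2 ≤ (2 * |v 0|) ^ 2 := by rw [mul_pow, sq_abs]; linarith
    exact (pow_le_pow_iff_left₀ hn (by positivity) two_ne_zero).1 h'
  have h6 := (abs_le.1 (hE (Kerr.timeVector M a p) v)).1
  rw [Kerr.bilin_timeVector hp v] at h6
  have h8 : e * ‖Kerr.timeVector M a p‖ * ‖v‖ ≤ 1 / 8 * (2 * |v 0|) :=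
    mul_le_mul heV h5 hn (by norm_num)
  have h9 : 0 < v 0 := by
    by_contra hle
    rw [not_lt] at hle
    have habs : |v 0| = -v 0 := abs_of_nonpos hle
    have h0 : (Kerr.timeVector M a p).ofLp 0 = Kerr.timeVector M a p 0 := rfl
    have hv0 : v.ofLp 0 = v 0 := rfl
    nlinarith
  refine ⟨h9, ?_⟩
  rwa [abs_of_pos h9] at h5

/-- **Nondegeneracy of a perturbed boosted Kerr–Schild form.** If a symmetric form `m` satisfies
`|m(Lv, Lw) − g_{M,a}(p)(v, w)| ≤ e ‖v‖ ‖w‖` with `e ≤ 1/4` and `e ‖V_p‖² ≤ 1/2` (`r(p) > 0`, `M ≥ 0`), then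
`m` is nondegenerate: in the rest frame it is positive on `{v⁰ = 0}` (`≥ (1 − e)‖u‖²`) and negative on `V_p`
(`≤ −1 + 1/2`). O'Neill 1983, Ch. 5, Lemma 5.26. [cite: ONeillSemiRiemannian1983, Ch. 5, Lemma 5.26] -/
theorem nondegenerate_of_perturbed (hM : 0 ≤ M) {p : E4} (hp : 0 < Kerr.radius a p)
    (m : E4 →L[ℝ] E4 →L[ℝ] ℝ) (hsymm : ∀ X Y : E4, m X Y = m Y X) (L : E4 ≃L[ℝ] E4) {e : ℝ}
    (he : e ≤ 1 / 4) (heV : e * ‖Kerr.timeVector M a p‖ ^ 2 ≤ 1 / 2)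
    (hE : ∀ v w : E4, |m (L v) (L w) - Kerr.bilin M a p v w| ≤ e * ‖v‖ * ‖w‖) :
    ∀ X : E4, (∀ Y : E4, m X Y = 0) → X = 0 := by
  let g' : E4 →L[ℝ] E4 →L[ℝ] ℝ :=
    (ContinuousLinearMap.precomp ℝ (L : E4 →L[ℝ] E4)).comp (m.comp (L : E4 →L[ℝ] E4))
  have hg' : ∀ v w : E4, g' v w = m (L v) (L w) := fun v w => rfl
  have hsymm' : ∀ v w : E4, g' v w = g' w v := fun v w => by rw [hg', hg', hsymm]
  have hS : ∀ u : E4, u 0 = 0 → u ≠ 0 → 0 < g' u u := by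
    intro u hu0 hu
    rw [hg']
    have h1 := kerr_self_ge (a := a) hM p u
    have h2 := (abs_le.1 (hE u u)).1
    have hn : 0 < ‖u‖ := norm_pos_iff.2 hu
    have hu0' : u.ofLp 0 = u 0 := rfl
    rw [hu0] at hu0'
    have h3 : 0 < (1 - e) * (‖u‖ * ‖u‖) := mul_pos (by linarith) (mul_pos hn hn)
    nlinarith
  have ht : g' (Kerr.timeVector M a p) (Kerr.timeVector M a p) < 0 := by
    rw [hg']
    have h1 : Kerr.bilin M a p (Kerr.timeVector M a p) (Kerr.timeVector M a p) ≤ -1 := by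
      rw [Kerr.bilin_timeVector_timeVector hp]; linarith [Kerr.scalarH_nonneg hM a p]
    have h2 := (abs_le.1 (hE (Kerr.timeVector M a p) (Kerr.timeVector M a p))).2
    nlinarith
  intro X hX
  have hv : L.symm X = 0 := by
    refine Minkowski.nondegenerate_of_spatial_pos hsymm' hS ht (L.symm X) fun w => ?_
    rw [hg', L.apply_symm_apply]
    exact hX (L w)
  calc X = L (L.symm X) := (L.apply_symm_apply X).symm
    _ = 0 := by rw [hv, map_zero]

/-- The set of normalised rest-frame directions `{v⁰ = 1, ‖v‖ ≤ 2}` is compact. [folklore] -/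
private theorem isCompact_normalisedDirections : IsCompact {v : E4 | v 0 = 1 ∧ ‖v‖ ≤ 2} :=
  (isCompact_closedBall (0 : E4) 2).of_isClosed_subset
    ((isClosed_eq continuous_apply_zero_E4 continuous_const).inter
      (isClosed_le continuous_norm continuous_const))
    fun _ hv => mem_closedBall_zero_iff.2 hv.2

/-! ### §3 The chart side: transport helpers and the horizon anchor in a time-oriented spacetime -/

section Chart

variable (𝓢 : Spacetime.{0} 4)

/-- Transport of future-directedness along equalities of base point and vector (all tangent spaces
of `𝓢` are the model space `E4`). [folklore] -/
private theorem isFutureDirected_transport {p q : 𝓢.carrier} (hpq : p = q) {X Y : E4} (hXY : X = Y)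
    (h : 𝓢.timeOrientation.IsFutureDirected (x := p) X) :
    𝓢.timeOrientation.IsFutureDirected (x := q) Y := by
  subst hpq hXY; exact h

/-- A vector of negative length is causal. [folklore] -/
private theorem isCausal_of_val_lt_zero {p : 𝓢.carrier} {X : E4} (h : 𝓢.metric.val p X X < 0) :
    𝓢.metric.IsCausal (x := p) X :=
  ⟨h.le, fun h0 => by subst h0; simp at h⟩

set_option maxHeartbeats 4000000 in
/-- **The horizon anchor in a time-oriented spacetime** (the content of NAMED FACT (A)
`HorizonLeafAnchor`, for a chart `Φ` of ANY `Spacetime 4` on a model background `B` whose form, time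
and radius functions are those of the boosted Kerr–Schild background with motion `(Λ, c)` and whose
chart domain lies in `{r > r₊ − h}`).  PROOF (by contradiction at a late point `w` of the leaf
`{r = r₊}`).  Constants: `K = ‖Λ‖ ≥ 1`, `C_V = sup_{r = r₊} ‖V‖` (`V = −g♯dt*`), `A = C_V + 1`,
`ε = 1/(16 K² A²)`.  (1) In the chart `ψ = Φ ∘ (chart at w)⁻¹` the components `m = (g(dψ·, dψ·))` are
continuous on the chart domain (`contDiffOn_metricInCoords`) and `‖m_w − g_B(w)‖ ≤ ε` (the `C¹` size
hypothesis at the late time `t*(w)`); hence on a ball `S ∋ w`: `‖m_y − g_B(y)‖ < 2ε`, `‖V_y‖ < A`, so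
`m_y(ΛV_y, ΛV_y) < 0` and — `S` being preconnected and `dΦ(ΛV)` future-directed at `w` by (2) —
`dψ_y(ΛV_y)` is future-directed on `S` (`isFutureDirected_mfderiv_apply_of_isPreconnected`).
(2) CONE CONTROL (`cone_control`): a future-directed `dψ_y(Λv)`, `y ∈ S`, has `v⁰ > 0` and `‖v‖ ≤ 2v⁰`.
(3) TUBE: if the conclusion failed at `w`, every `v` with `v⁰ > 0`, `m_w(Λv, Λv) ≤ 0` has `dr(v) < 0`;
by continuity of `(y, v) ↦ (m_y(Λv, Λv), dr_y(v))` and compactness of `{v⁰ = 1, ‖v‖ ≤ 2}`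
(`IsCompact.eventually_forall_of_forall_eventually`) the implication `m_y(Λv, Λv) ≤ 0 → dr_y(v) < 0`
persists on a smaller ball, whence (normalising by `v⁰`) EVERY future-directed `dψ_y(Λv)`, `y ∈ S`, has
`(Λ⁻¹·)⁰ > 0` and `dr_y < 0`.  (4) `m_w` is nondegenerate (`nondegenerate_of_perturbed`: positive on
`Λ{v⁰ = 0}`, negative on `ΛV_w`), so `ψ` is a local diffeomorphism at `w`
(`isLocalDiffeomorphAt_of_metricInCoords_nondegenerate`) with local inverse `e`.  (5) By (3c) with
`T = 1` there is a leaf point `w'` with `t*(w') ≥ t*(w) + 1` and `Φ w' ∈ J⁺(Φ w)`; `Φ w' = Φ w` is excluded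
by lateness-injectivity, so a future causal curve `γ : [a', b'] → M` runs from `Φ w` to `Φ w'`.  Its germ
lifts: `β = e ∘ γ` on `[a', a' + δ]` stays in `S`, `γ = ψ ∘ β` there, and by the chain rule
`γ̇ = dψ_β(β̇)` is future-directed, so by (3) `t* ∘ β` is nondecreasing and `r ∘ β` strictly decreasing
(`monotoneOn_of_deriv_nonneg`, `strictAntiOn_of_deriv_neg`, `Kerr.hasFDerivAt_radius`): the chart point
`ζ = β(a' + δ)` is late with `r(ζ) < r₊` and `Φ ζ = γ(a' + δ)`.  (6) The tail `γ|[a' + δ, b']` puts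
`Φ w' ∈ J⁺(Φ ζ)` with `r(w') = r₊ ≤ r₊ + h` — contradicting (3b).  O'Neill 1983, Ch. 5 (Lemmas 5.26–5.30:
causal cones of a Lorentz form), Ch. 14 (causality); Visser arXiv:0706.0622 §4 (Kerr–Schild form).
[cite: ONeillSemiRiemannian1983, Ch. 14, Lemma 14.2] -/
theorem horizonLeafAnchor_model (B : ModelBackground) (Λ : lorentzGroup) (c : E4) {M : ℝ} (a : ℝ)
    (hM : 0 < M) {h : ℝ} (hh : 0 < h) (hhr : h < Kerr.rPlus M a)
    (hBb : B.bilin = boostedKerrBilin Λ c M a) (hBt : ∀ x : E4, B.time x = poincareInv Λ c x 0)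
    (hBr : ∀ x : E4, B.radius x = Kerr.radius a (poincareInv Λ c x))
    (hBd : ∀ z : E4, z ∈ (B.domain : Set E4) → Kerr.rPlus M a - h < Kerr.radius a (poincareInv Λ c z)) :
    ∃ ε : ℝ, 0 < ε ∧
    ∀ Φ : B.domain → 𝓢.carrier, ContMDiff 𝓘(ℝ, E4) (𝓡 4) ((⊤ : ℕ∞) : WithTop ℕ∞) Φ →
    ∀ τ₁ : ℝ, Set.InjOn Φ {w | τ₁ ≤ B.time w.1} →
    (∀ τ : ℝ, τ₁ ≤ τ → 𝓢.truncDeviationCk B Φ 1 (Kerr.rPlus M a + h) τ ≤ ENNReal.ofReal ε) →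
    (∀ w : B.domain, τ₁ ≤ B.time w.1 → B.radius w.1 ≤ Kerr.rPlus M a + h →
      𝓢.timeOrientation.IsFutureDirected
        (mfderiv 𝓘(ℝ, E4) (𝓡 4) Φ w ((Λ : E4 ≃L[ℝ] E4) (Kerr.timeVector M a (poincareInv Λ c w.1))))) →
    (∀ w w' : B.domain, τ₁ ≤ B.time w.1 → τ₁ ≤ B.time w'.1 → B.radius w.1 < Kerr.rPlus M a →
      Kerr.rPlus M a ≤ B.radius w'.1 → B.radius w'.1 ≤ Kerr.rPlus M a + h →
      Φ w' ∉ 𝓢.metric.causalFuture 𝓢.timeOrientation {Φ w}) →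
    (∀ w : B.domain, τ₁ ≤ B.time w.1 → B.radius w.1 = Kerr.rPlus M a → ∀ T : ℝ,
      ∃ w' : B.domain, B.radius w'.1 = Kerr.rPlus M a ∧ B.time w.1 + T ≤ B.time w'.1 ∧
        Φ w' ∈ 𝓢.metric.causalFuture 𝓢.timeOrientation {Φ w}) →
    ∀ w : B.domain, τ₁ ≤ B.time w.1 → B.radius w.1 = Kerr.rPlus M a →
      ∃ v : E4, 0 < v 0 ∧
        𝓢.metric.val (Φ w) (mfderiv 𝓘(ℝ, E4) (𝓡 4) Φ w ((Λ : E4 ≃L[ℝ] E4) v))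
          (mfderiv 𝓘(ℝ, E4) (𝓡 4) Φ w ((Λ : E4 ≃L[ℝ] E4) v)) ≤ 0 ∧
        0 ≤ Kerr.radiusGrad a (E4.spatial (poincareInv Λ c w.1)) (E4.spatial v) := by
  -- the outer horizon radius
  obtain ⟨rp, hrpdef⟩ : ∃ rp : ℝ, Kerr.rPlus M a = rp := ⟨_, rfl⟩
  have hrpM : M ≤ rp := hrpdef ▸ le_rPlus M a
  have hrp0 : 0 < rp := lt_of_lt_of_le hM hrpM
  rw [hrpdef] at hhr hBd
  simp only [hrpdef]
  -- the Lorentz factor `K = ‖Λ‖ ≥ 1`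
  obtain ⟨KΛ, hKΛ⟩ : ∃ K : ℝ, ‖((Λ : E4 ≃L[ℝ] E4) : E4 →L[ℝ] E4)‖ = K := ⟨_, rfl⟩
  have hK1 : 1 ≤ KΛ := by rw [← hKΛ]; exact BoostedKerrLegs.one_le_norm_lorentz Λ
  have hK0 : 0 < KΛ := lt_of_lt_of_le one_pos hK1
  have hΛle : ∀ v : E4, ‖(Λ : E4 ≃L[ℝ] E4) v‖ ≤ KΛ * ‖v‖ := fun v => by
    rw [← hKΛ]; exact ((Λ : E4 ≃L[ℝ] E4) : E4 →L[ℝ] E4).le_opNorm v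
  -- the uniform bound `C_V` of `‖V‖` on the leaf `{r = r₊}` and the threshold
  obtain ⟨CV, CW, hCV, hCW, hbd⟩ := bound_package M a (r₁ := rp) (r₂ := rp) hrp0 le_rfl
  have hCV0 : 0 < CV := lt_of_lt_of_le one_pos hCV
  obtain ⟨A, hAdef⟩ : ∃ A : ℝ, A = CV + 1 := ⟨_, rfl⟩
  have hCVA : CV ≤ A := by rw [hAdef]; linarith
  have hA2 : 2 ≤ A := by rw [hAdef]; linarith
  have hA0 : 0 < A := by linarith
  have hAne : A ≠ 0 := hA0.ne'
  have hKne : KΛ ≠ 0 := hK0.ne'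
  obtain ⟨ε, hεdef⟩ : ∃ ε : ℝ, ε = 1 / (16 * KΛ ^ 2 * A ^ 2) := ⟨_, rfl⟩
  have hε0 : 0 < ε := by rw [hεdef]; positivity
  have hεK : ε * KΛ ^ 2 = 1 / (16 * A ^ 2) := by rw [hεdef]; field_simp
  have htA2 : ε * KΛ ^ 2 * A ^ 2 = 1 / 16 := by rw [hεdef]; field_simp
  have htA : ε * KΛ ^ 2 * A = 1 / (16 * A) := by rw [hεdef]; field_simp
  have ht64 : ε * KΛ ^ 2 ≤ 1 / 64 := by
    rw [hεK]; exact one_div_le_one_div_of_le (by norm_num) (by nlinarith)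
  have he_w : ε * KΛ ^ 2 ≤ 1 / 4 := by linarith
  have he_wV : ε * KΛ ^ 2 * CV ^ 2 ≤ 1 / 2 := by
    have h1 : ε * KΛ ^ 2 * CV ^ 2 ≤ ε * KΛ ^ 2 * A ^ 2 :=
      mul_le_mul_of_nonneg_left (pow_le_pow_left₀ hCV0.le hCVA 2) (by positivity)
    linarith
  have he_S : 2 * ε * KΛ ^ 2 ≤ 1 / 4 := by linarith
  have he_SA : 2 * ε * KΛ ^ 2 * A ≤ 1 / 8 := by
    have h1 : 1 / (16 * A) ≤ 1 / 32 := one_div_le_one_div_of_le (by norm_num) (by linarith)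
    nlinarith
  refine ⟨ε, hε0, ?_⟩
  intro Φ hΦ τ₁ hinj hdev hfd h3b h3c w hw0 hwr
  by_contra hneg
  have hneg' : ∀ v : E4, 0 < v 0 →
      𝓢.metric.val (Φ w) (mfderiv 𝓘(ℝ, E4) (𝓡 4) Φ w ((Λ : E4 ≃L[ℝ] E4) v))
        (mfderiv 𝓘(ℝ, E4) (𝓡 4) Φ w ((Λ : E4 ≃L[ℝ] E4) v)) ≤ 0 →
      Kerr.radiusGrad a (E4.spatial (poincareInv Λ c w.1)) (E4.spatial v) < 0 :=
    fun v h1 h2 => lt_of_not_ge fun h3 => hneg ⟨v, h1, h2, h3⟩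
  /- ── basic facts at `w` ── -/
  have hwO : w.1 ∈ (B.domain : Set E4) := w.2
  have hO : IsOpen (B.domain : Set E4) := B.domain.2
  have hrw : Kerr.radius a (poincareInv Λ c w.1) = rp := by rw [← hBr]; exact hwr
  have hrw0 : 0 < Kerr.radius a (poincareInv Λ c w.1) := by rw [hrw]; exact hrp0
  have hrO : ∀ z : E4, z ∈ (B.domain : Set E4) → 0 < Kerr.radius a (poincareInv Λ c z) :=
    fun z hz => lt_trans (by linarith) (hBd z hz)
  have hVw : ‖Kerr.timeVector M a (poincareInv Λ c w.1)‖ ≤ CV := (hbd _ hrw.ge hrw.le).1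
  have hBuv : ∀ y v v' : E4, B.bilin y ((Λ : E4 ≃L[ℝ] E4) v) ((Λ : E4 ≃L[ℝ] E4) v') =
      Kerr.bilin M a (poincareInv Λ c y) v v' := fun y v v' => by
    rw [hBb, boostedKerrBilin_apply_boost]
  /- ── the chart `ψ = Φ ∘ (chart at w)⁻¹` and its metric components `m` ── -/
  set ψ : E4 → 𝓢.carrier := Φ ∘ (chartAt E4 w).symm with hψdef
  have hΦd : ∀ x : B.domain, MDifferentiableAt 𝓘(ℝ, E4) (𝓡 4) Φ x := fun x =>
    (hΦ x).mdifferentiableAt (by simp)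
  have hψs : ContMDiffOn 𝓘(ℝ, E4) (𝓡 4) ((⊤ : ℕ∞) : WithTop ℕ∞) ψ (B.domain : Set E4) :=
    𝓢.contMDiffOn_comp_chartAt_symm B Φ w hΦ
  have hψΦ : ∀ (y : E4) (hy : y ∈ (B.domain : Set E4)), ψ y = Φ ⟨y, hy⟩ := fun y hy => by
    show Φ ((chartAt E4 w).symm y) = Φ ⟨y, hy⟩
    rw [show (chartAt E4 w).symm y = ⟨y, hy⟩ from Subtype.ext (OpensChart.chartAt_symm_val w hy)]
  have hdψ : ∀ (y : E4) (hy : y ∈ (B.domain : Set E4)) (X : E4),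
      mfderiv 𝓘(ℝ, E4) (𝓡 4) ψ y X = mfderiv 𝓘(ℝ, E4) (𝓡 4) Φ ⟨y, hy⟩ X := fun y hy X =>
    𝓢.mfderiv_comp_chartAt_symm_apply B Φ w hy (hΦd _) X
  have hψd : ∀ y : E4, y ∈ (B.domain : Set E4) → MDifferentiableAt 𝓘(ℝ, E4) (𝓡 4) ψ y :=
    fun y hy => 𝓢.mdifferentiableAt_comp_chartAt_symm B Φ w hy (hΦd _)
  set m : E4 → E4 →L[ℝ] E4 →L[ℝ] ℝ := 𝓢.metricInCoords ψ with hmdef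
  have hmc : ContinuousOn m (B.domain : Set E4) :=
    (𝓢.contDiffOn_metricInCoords hO hψs).continuousOn
  have hmapp : ∀ y X Y : E4, m y X Y =
      𝓢.metric.val (ψ y) (mfderiv 𝓘(ℝ, E4) (𝓡 4) ψ y X) (mfderiv 𝓘(ℝ, E4) (𝓡 4) ψ y Y) :=
    fun y X Y => 𝓢.metricInCoords_apply ψ y X Y
  have hmΦ : ∀ (y : E4) (hy : y ∈ (B.domain : Set E4)) (X Y : E4), m y X Y =
      𝓢.metric.val (Φ ⟨y, hy⟩) (mfderiv 𝓘(ℝ, E4) (𝓡 4) Φ ⟨y, hy⟩ X)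
        (mfderiv 𝓘(ℝ, E4) (𝓡 4) Φ ⟨y, hy⟩ Y) :=
    fun y hy X Y => 𝓢.metricInCoords_comp_chartAt_symm_apply B Φ w hy (hΦd _) X Y
  have hmdev : ∀ (y : E4) (hy : y ∈ (B.domain : Set E4)),
      m y - B.bilin y = 𝓢.deviation B Φ ⟨y, hy⟩ :=
    fun y hy => 𝓢.metricInCoords_comp_chartAt_symm_sub_eq_deviation B Φ w hy (hΦd _)
  -- the error form: `|m_y(Λv, Λv') − g_{M,a}(Λ⁻¹(y − c))(v, v')| ≤ η K² ‖v‖ ‖v'‖` when `‖m_y − g_B(y)‖ ≤ η`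
  have herr : ∀ (y : E4) {η : ℝ}, ‖m y - B.bilin y‖ ≤ η → ∀ v v' : E4,
      |m y ((Λ : E4 ≃L[ℝ] E4) v) ((Λ : E4 ≃L[ℝ] E4) v') - Kerr.bilin M a (poincareInv Λ c y) v v'| ≤
        η * KΛ ^ 2 * ‖v‖ * ‖v'‖ := fun y η hη v v' =>
    perturbed_error_le (m y) (B.bilin y) (Kerr.bilin M a (poincareInv Λ c y)) (Λ : E4 ≃L[ℝ] E4)
      (hBuv y) hη hK0.le hΛle v v'
  /- ── (1) the deviation at `w` ── -/
  have hdevw : ‖m w.1 - B.bilin w.1‖ ≤ ε := by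
    rw [hmdev w.1 hwO]
    have hxS : w ∈ B.truncTimeSlab (rp + h) (B.time w.1) := ⟨rfl, by rw [hwr]; linarith⟩
    exact BoostedKerrLegs.norm_deviation_le_of_supCkENorm_le 𝓢 B Φ hε0.le (hdev (B.time w.1) hw0) w hxS
  /- ── continuity at `w` of the data ── -/
  have hPc : Continuous (poincareInv Λ c) := continuous_poincareInv Λ c
  have hVc : ∀ z : E4, z ∈ (B.domain : Set E4) →
      ContinuousAt (fun y : E4 => (Λ : E4 ≃L[ℝ] E4) (Kerr.timeVector M a (poincareInv Λ c y))) z :=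
    fun z hz => (Λ : E4 ≃L[ℝ] E4).continuous.continuousAt.comp
      ((continuousAt_timeVector M a (hrO z hz)).comp hPc.continuousAt)
  have hVc' : ContinuousAt (fun y : E4 => Kerr.timeVector M a (poincareInv Λ c y)) w.1 :=
    (continuousAt_timeVector M a hrw0).comp hPc.continuousAt
  have hmcw : ContinuousAt m w.1 := hmc.continuousAt (hO.mem_nhds hwO)
  have hBc : ContinuousAt B.bilin w.1 := by
    rw [hBb]; exact (contDiffAt_boostedKerrBilin Λ c M a hrw0 (n := 0)).continuousAt
  /- ── the ball `S` ── -/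
  have hS1 : ∀ᶠ y in 𝓝 w.1, y ∈ (B.domain : Set E4) := hO.mem_nhds hwO
  have hS2 : ∀ᶠ y in 𝓝 w.1, ‖m y - B.bilin y‖ < 2 * ε :=
    Filter.Tendsto.eventually_lt_const (show ‖m w.1 - B.bilin w.1‖ < 2 * ε by linarith)
      (hmcw.sub hBc).norm
  have hS4 : ∀ᶠ y in 𝓝 w.1, ‖Kerr.timeVector M a (poincareInv Λ c y)‖ < A :=
    Filter.Tendsto.eventually_lt_const (show ‖Kerr.timeVector M a (poincareInv Λ c w.1)‖ < A by
      linarith) hVc'.norm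
  -- the tube: `m_y(Λv, Λv) ≤ 0 → dr_y(v) < 0` for all normalised `v`, for `y` near `w`
  have hKc := isCompact_normalisedDirections
  have hS5 : ∀ᶠ y in 𝓝 w.1, ∀ v ∈ {v : E4 | v 0 = 1 ∧ ‖v‖ ≤ 2},
      m y ((Λ : E4 ≃L[ℝ] E4) v) ((Λ : E4 ≃L[ℝ] E4) v) ≤ 0 →
        Kerr.radiusGrad a (E4.spatial (poincareInv Λ c y)) (E4.spatial v) < 0 := by
    refine hKc.eventually_forall_of_forall_eventually
      (P := fun y v => m y ((Λ : E4 ≃L[ℝ] E4) v) ((Λ : E4 ≃L[ℝ] E4) v) ≤ 0 →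
        Kerr.radiusGrad a (E4.spatial (poincareInv Λ c y)) (E4.spatial v) < 0) fun v₀ hv₀ => ?_
    have hq : ContinuousAt
        (fun z : E4 × E4 => m z.1 ((Λ : E4 ≃L[ℝ] E4) z.2) ((Λ : E4 ≃L[ℝ] E4) z.2)) (w.1, v₀) := by
      have h1 : ContinuousAt (fun z : E4 × E4 => m z.1) (w.1, v₀) := hmcw.comp_of_eq continuousAt_fst rfl
      have h2 : ContinuousAt (fun z : E4 × E4 => (Λ : E4 ≃L[ℝ] E4) z.2) (w.1, v₀) :=
        ((Λ : E4 ≃L[ℝ] E4).continuous.comp continuous_snd).continuousAt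
      exact (h1.clm_apply h2).clm_apply h2
    have hd : ContinuousAt
        (fun z : E4 × E4 => Kerr.radiusGrad a (E4.spatial (poincareInv Λ c z.1)) (E4.spatial z.2))
        (w.1, v₀) := by
      have h1 : ContinuousAt
          (fun z : E4 × E4 => Kerr.radiusGradVec a (E4.spatial (poincareInv Λ c z.1))) (w.1, v₀) :=
        ((continuousAt_radiusGradVec_spatial a hrw0).comp hPc.continuousAt).comp_of_eq continuousAt_fst rfl
      have h2 : ContinuousAt (fun z : E4 × E4 => E4.spatial z.2) (w.1, v₀) :=
        (E4.spatial.continuous.comp continuous_snd).continuousAt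
      simp only [Kerr.radiusGrad_apply]
      exact h1.inner h2
    by_cases hpos : 0 < m w.1 ((Λ : E4 ≃L[ℝ] E4) v₀) ((Λ : E4 ≃L[ℝ] E4) v₀)
    · exact (Filter.Tendsto.eventually_const_lt hpos hq).mono fun z hz hle => absurd hle (not_le.2 hz)
    · have hle : m w.1 ((Λ : E4 ≃L[ℝ] E4) v₀) ((Λ : E4 ≃L[ℝ] E4) v₀) ≤ 0 := not_lt.1 hpos
      rw [hmΦ w.1 hwO] at hle
      have hneg0 : Kerr.radiusGrad a (E4.spatial (poincareInv Λ c w.1)) (E4.spatial v₀) < 0 :=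
        hneg' v₀ (by rw [hv₀.1]; exact one_pos) hle
      exact (Filter.Tendsto.eventually_lt_const hneg0 hd).mono fun z hz _ => hz
  obtain ⟨ρ, hρ0, hball⟩ := Metric.eventually_nhds_iff.1 (hS1.and (hS2.and (hS4.and hS5)))
  set S : Set E4 := Metric.ball w.1 ρ with hSdef
  have hwS : w.1 ∈ S := Metric.mem_ball_self hρ0
  have hSO : S ⊆ (B.domain : Set E4) := fun y hy => (hball (Metric.mem_ball.1 hy)).1
  have hSpre : IsPreconnected S := (convex_ball w.1 ρ).isPreconnected
  have hSo : IsOpen S := Metric.isOpen_ball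
  have hSdev : ∀ y ∈ S, ‖m y - B.bilin y‖ ≤ 2 * ε := fun y hy => (hball (Metric.mem_ball.1 hy)).2.1.le
  have hSV : ∀ y ∈ S, ‖Kerr.timeVector M a (poincareInv Λ c y)‖ ≤ A := fun y hy =>
    (hball (Metric.mem_ball.1 hy)).2.2.1.le
  have hStube : ∀ y ∈ S, ∀ v ∈ {v : E4 | v 0 = 1 ∧ ‖v‖ ≤ 2},
      m y ((Λ : E4 ≃L[ℝ] E4) v) ((Λ : E4 ≃L[ℝ] E4) v) ≤ 0 →
        Kerr.radiusGrad a (E4.spatial (poincareInv Λ c y)) (E4.spatial v) < 0 := fun y hy =>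
    (hball (Metric.mem_ball.1 hy)).2.2.2
  have hSr : ∀ y ∈ S, 0 < Kerr.radius a (poincareInv Λ c y) := fun y hy => hrO y (hSO hy)
  have he_SV : ∀ y ∈ S, 2 * ε * KΛ ^ 2 * ‖Kerr.timeVector M a (poincareInv Λ c y)‖ ≤ 1 / 8 :=
    fun y hy => (mul_le_mul_of_nonneg_left (hSV y hy) (by positivity)).trans he_SA
  /- ── `ΛV` is `m`-timelike on `S` ── -/
  have hQVS : ∀ y ∈ S, m y ((Λ : E4 ≃L[ℝ] E4) (Kerr.timeVector M a (poincareInv Λ c y)))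
      ((Λ : E4 ≃L[ℝ] E4) (Kerr.timeVector M a (poincareInv Λ c y))) < 0 := by
    intro y hy
    have h1 := (abs_le.1 (herr y (hSdev y hy) (Kerr.timeVector M a (poincareInv Λ c y))
      (Kerr.timeVector M a (poincareInv Λ c y)))).2
    have h2 : Kerr.bilin M a (poincareInv Λ c y) (Kerr.timeVector M a (poincareInv Λ c y))
        (Kerr.timeVector M a (poincareInv Λ c y)) ≤ -1 := by
      rw [Kerr.bilin_timeVector_timeVector (hSr y hy)]
      linarith [Kerr.scalarH_nonneg hM.le a (poincareInv Λ c y)]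
    have h3 : 2 * ε * KΛ ^ 2 * ‖Kerr.timeVector M a (poincareInv Λ c y)‖ *
        ‖Kerr.timeVector M a (poincareInv Λ c y)‖ ≤ 2 * ε * KΛ ^ 2 * A * A :=
      mul_le_mul (mul_le_mul_of_nonneg_left (hSV y hy) (by positivity)) (hSV y hy) (norm_nonneg _)
        (by positivity)
    have h4 : 2 * ε * KΛ ^ 2 * A * A = 1 / 8 := by linear_combination 2 * htA2
    linarith
  /- ── (1') `dψ(ΛV)` is future-directed on `S` ── -/
  have hfdS : ∀ y ∈ S, 𝓢.timeOrientation.IsFutureDirected (x := ψ y)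
      (mfderiv 𝓘(ℝ, E4) (𝓡 4) ψ y ((Λ : E4 ≃L[ℝ] E4) (Kerr.timeVector M a (poincareInv Λ c y)))) := by
    refine 𝓢.isFutureDirected_mfderiv_apply_of_isPreconnected hO hψs hSpre hSO
      (fun y => (Λ : E4 ≃L[ℝ] E4) (Kerr.timeVector M a (poincareInv Λ c y)))
      (fun z hz => (hVc z hz).continuousWithinAt) (fun y hy => ?_) hwS ?_
    · exact isCausal_of_val_lt_zero 𝓢 (by rw [← hmapp]; exact hQVS y hy)
    · exact isFutureDirected_transport 𝓢 (hψΦ w.1 hwO).symm (hdψ w.1 hwO _).symm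
        (hfd w hw0 (by rw [hwr]; linarith))
  /- ── (2)+(3) every future-directed `dψ_y(Λv)`, `y ∈ S`, has `v⁰ > 0` and `dr_y(v) < 0` ── -/
  have hcone : ∀ y ∈ S, ∀ v : E4,
      𝓢.timeOrientation.IsFutureDirected (x := ψ y) (mfderiv 𝓘(ℝ, E4) (𝓡 4) ψ y ((Λ : E4 ≃L[ℝ] E4) v)) →
      0 < v 0 ∧ Kerr.radiusGrad a (E4.spatial (poincareInv Λ c y)) (E4.spatial v) < 0 := by
    intro y hy v hv
    have hVt : 𝓢.metric.IsTimelike (x := ψ y)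
        (mfderiv 𝓘(ℝ, E4) (𝓡 4) ψ y ((Λ : E4 ≃L[ℝ] E4) (Kerr.timeVector M a (poincareInv Λ c y)))) := by
      show 𝓢.metric.val (ψ y) _ _ < 0
      rw [← hmapp]; exact hQVS y hy
    have hcross : m y ((Λ : E4 ≃L[ℝ] E4) (Kerr.timeVector M a (poincareInv Λ c y)))
        ((Λ : E4 ≃L[ℝ] E4) v) < 0 := by
      rw [hmapp]; exact TimeOrientation.IsFutureDirected.val_lt_zero _ (hfdS y hy) hVt hv
    have hself : m y ((Λ : E4 ≃L[ℝ] E4) v) ((Λ : E4 ≃L[ℝ] E4) v) ≤ 0 := by rw [hmapp]; exact hv.1.1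
    have hcc := cone_control (a := a) hM.le (hSr y hy)
      (Q := fun v v' => m y ((Λ : E4 ≃L[ℝ] E4) v) ((Λ : E4 ≃L[ℝ] E4) v')) (e := 2 * ε * KΛ ^ 2)
      he_S (he_SV y hy) (herr y (hSdev y hy)) hself hcross
    have hv0 : 0 < v 0 := hcc.1
    refine ⟨hv0, ?_⟩
    -- normalise: `v' = v / v⁰ ∈ {v⁰ = 1, ‖v‖ ≤ 2}`
    have hv'0 : ((v 0)⁻¹ • v) 0 = 1 := by
      show (v 0)⁻¹ * v 0 = 1
      exact inv_mul_cancel₀ hv0.ne'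
    have hv'n : ‖(v 0)⁻¹ • v‖ ≤ 2 := by
      rw [norm_smul, Real.norm_eq_abs, abs_inv, abs_of_pos hv0, inv_mul_le_iff₀ hv0]
      linarith [hcc.2]
    have hq' : m y ((Λ : E4 ≃L[ℝ] E4) ((v 0)⁻¹ • v)) ((Λ : E4 ≃L[ℝ] E4) ((v 0)⁻¹ • v)) ≤ 0 := by
      simp only [map_smul, FunLike.coe_smul, Pi.smul_apply, smul_eq_mul]
      nlinarith [mul_nonneg (inv_pos.2 hv0).le (inv_pos.2 hv0).le, hself]
    have hd' := hStube y hy ((v 0)⁻¹ • v) ⟨hv'0, hv'n⟩ hq'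
    rw [map_smul, map_smul, smul_eq_mul] at hd'
    exact lt_of_not_ge fun hge => absurd hd' (not_lt.2 (mul_nonneg (inv_pos.2 hv0).le hge))
  /- ── (4) `ψ` is a local diffeomorphism at `w` ── -/
  have hnd : ∀ X : E4, (∀ Y : E4, m w.1 X Y = 0) → X = 0 :=
    nondegenerate_of_perturbed (a := a) hM.le hrw0 (m w.1) (fun X Y => 𝓢.metricInCoords_symm ψ w.1 X Y)
      (Λ : E4 ≃L[ℝ] E4) (e := ε * KΛ ^ 2) he_w
      ((mul_le_mul_of_nonneg_left (pow_le_pow_left₀ (norm_nonneg _) hVw 2) (by positivity)).trans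
        he_wV) (herr w.1 hdevw)
  have hloc : IsLocalDiffeomorphAt 𝓘(ℝ, E4) (𝓡 4) ((⊤ : ℕ∞) : WithTop ℕ∞) ψ w.1 :=
    𝓢.isLocalDiffeomorphAt_of_metricInCoords_nondegenerate hO hψs hwO hnd
  set e := hloc.localInverse with hedef
  have hes : ψ w.1 ∈ e.source := hloc.localInverse_mem_source
  have hew : e (ψ w.1) = w.1 := hloc.localInverse_left_inv hloc.localInverse_mem_target
  have heright : ∀ z, z ∈ e.source → ψ (e z) = z := fun z hz => hloc.localInverse_right_inv hz
  have heo : IsOpen e.source := e.open_source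
  have hec : ∀ z, z ∈ e.source → ContinuousAt e z := fun z hz =>
    (e.contMDiffOn.contMDiffAt (heo.mem_nhds hz)).continuousAt
  have hed : ∀ z, z ∈ e.source → MDifferentiableAt (𝓡 4) 𝓘(ℝ, E4) e z := fun z hz =>
    e.mdifferentiableAt (by simp) hz
  /- ── (5) the successor leaf point `w'` and the causal curve ── -/
  obtain ⟨w', hw'r, hw't, hJ⟩ := h3c w hw0 hwr 1
  have hw'late : τ₁ ≤ B.time w'.1 := by linarith
  rcases hJ with hmem | ⟨p, hp, γ, a', b', hab, hγ, hγa, hγb⟩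
  · -- `Φ w' = Φ w`: excluded by lateness-injectivity and the time gain
    have heq : w' = w := hinj hw'late hw0 (Set.mem_singleton_iff.1 hmem)
    rw [heq] at hw't
    linarith
  rw [Set.mem_singleton_iff.1 hp] at hγa
  have hγa' : γ a' = ψ w.1 := by rw [hγa, hψΦ w.1 hwO]
  -- the germ of `γ` at `a'` lifts through `e` into `S`
  have hγc : ContinuousAt γ a' := (hγ a' (left_mem_Icc.2 hab.le)).1.continuousAt
  have hesγ : γ a' ∈ e.source := by rw [hγa']; exact hes
  have hβc : ContinuousAt (fun s => e (γ s)) a' := (hec _ hesγ).comp hγc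
  have hev1 : ∀ᶠ s in 𝓝 a', γ s ∈ e.source := hγc.preimage_mem_nhds (heo.mem_nhds hesγ)
  have hev2 : ∀ᶠ s in 𝓝 a', e (γ s) ∈ S := by
    refine hβc.preimage_mem_nhds (hSo.mem_nhds ?_)
    show e (γ a') ∈ S
    rw [hγa', hew]; exact hwS
  obtain ⟨δ₀, hδ₀, hδ⟩ := Metric.eventually_nhds_iff.1 (hev1.and hev2)
  obtain ⟨δ, hδdef⟩ : ∃ δ : ℝ, δ = min (δ₀ / 2) ((b' - a') / 2) := ⟨_, rfl⟩
  have hδ0 : 0 < δ := by rw [hδdef]; exact lt_min (by linarith) (by linarith)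
  have hδle₁ : δ ≤ δ₀ / 2 := hδdef ▸ min_le_left _ _
  have hδle₂ : δ ≤ (b' - a') / 2 := hδdef ▸ min_le_right _ _
  have hδ1 : a' + δ < b' := by linarith
  have hI : ∀ s ∈ Icc a' (a' + δ), γ s ∈ e.source ∧ e (γ s) ∈ S := fun s hs =>
    hδ (show dist s a' < δ₀ by rw [Real.dist_eq, abs_of_nonneg (by linarith [hs.1])]; linarith [hs.2])
  have hIsub : Icc a' (a' + δ) ⊆ Icc a' b' := Icc_subset_Icc le_rfl hδ1.le
  set β : ℝ → E4 := fun s => e (γ s) with hβdef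
  have hβa : β a' = w.1 := by show e (γ a') = w.1; rw [hγa', hew]
  -- the chain rule: `γ̇ = dψ_β(β̇)` on `[a', a' + δ]`
  have hβfacts : ∀ s ∈ Icc a' (a' + δ), β s ∈ S ∧ MDifferentiableAt 𝓘(ℝ, ℝ) 𝓘(ℝ, E4) β s ∧
      𝓢.timeOrientation.IsFutureDirected (x := ψ (β s))
        (mfderiv 𝓘(ℝ, E4) (𝓡 4) ψ (β s) (mfderiv 𝓘(ℝ, ℝ) 𝓘(ℝ, E4) β s 1)) := by
    intro s hs
    obtain ⟨hsrc, hβS⟩ := hI s hs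
    have hsI : s ∈ Icc a' b' := hIsub hs
    have hγd : MDifferentiableAt 𝓘(ℝ, ℝ) (𝓡 4) γ s := (hγ s hsI).1
    have hβd : MDifferentiableAt 𝓘(ℝ, ℝ) 𝓘(ℝ, E4) β s := (hed _ hsrc).comp s hγd
    have hnear : ∀ᶠ s' in 𝓝 s, γ s' ∈ e.source :=
      hγd.continuousAt.preimage_mem_nhds (heo.mem_nhds hsrc)
    have hev : γ =ᶠ[𝓝 s] (ψ ∘ β) := hnear.mono fun s' hs' => (heright _ hs').symm
    have hψd' : MDifferentiableAt 𝓘(ℝ, E4) (𝓡 4) ψ (β s) := hψd _ (hSO hβS)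
    have hchain : mfderiv 𝓘(ℝ, ℝ) (𝓡 4) γ s =
        (mfderiv 𝓘(ℝ, E4) (𝓡 4) ψ (β s)).comp (mfderiv 𝓘(ℝ, ℝ) 𝓘(ℝ, E4) β s) := by
      rw [hev.mfderiv_eq]; exact mfderiv_comp s hψd' hβd
    have hvel : velocity (𝓡 4) γ s =
        mfderiv 𝓘(ℝ, E4) (𝓡 4) ψ (β s) (mfderiv 𝓘(ℝ, ℝ) 𝓘(ℝ, E4) β s 1) := by
      show mfderiv 𝓘(ℝ, ℝ) (𝓡 4) γ s 1 = _
      rw [hchain]; rfl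
    have hγs : γ s = ψ (β s) := (heright _ hsrc).symm
    exact ⟨hβS, hβd, isFutureDirected_transport 𝓢 hγs hvel (hγ s hsI).2⟩
  -- real derivatives of `t* ∘ β` (positive) and `r ∘ β` (negative) on `[a', a' + δ]`
  have hderiv : ∀ s ∈ Icc a' (a' + δ),
      HasDerivAt (fun s => poincareInv Λ c (β s) 0) (((Λ : E4 ≃L[ℝ] E4).symm (deriv β s)) 0) s ∧
      HasDerivAt (fun s => Kerr.radius a (poincareInv Λ c (β s)))
        (Kerr.radiusGrad a (E4.spatial (poincareInv Λ c (β s)))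
          (E4.spatial ((Λ : E4 ≃L[ℝ] E4).symm (deriv β s)))) s ∧
      0 < ((Λ : E4 ≃L[ℝ] E4).symm (deriv β s)) 0 ∧
      Kerr.radiusGrad a (E4.spatial (poincareInv Λ c (β s)))
        (E4.spatial ((Λ : E4 ≃L[ℝ] E4).symm (deriv β s))) < 0 := by
    intro s hs
    obtain ⟨hβS, hβd, hfdβ⟩ := hβfacts s hs
    have hβD : HasDerivAt β (deriv β s) s := hβd.differentiableAt.hasDerivAt
    have hu : mfderiv 𝓘(ℝ, ℝ) 𝓘(ℝ, E4) β s 1 = deriv β s := by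
      rw [mfderiv_eq_fderiv]; rfl
    have hP : HasDerivAt (fun s => poincareInv Λ c (β s)) ((Λ : E4 ≃L[ℝ] E4).symm (deriv β s)) s := by
      show HasDerivAt (fun s => (Λ : E4 ≃L[ℝ] E4).symm (β s - c)) _ s
      exact ((Λ : E4 ≃L[ℝ] E4).symm : E4 →L[ℝ] E4).hasFDerivAt.comp_hasDerivAt s (hβD.sub_const c)
    have hT : HasDerivAt (fun s => poincareInv Λ c (β s) 0) (((Λ : E4 ≃L[ℝ] E4).symm (deriv β s)) 0) s :=
      (EuclideanSpace.proj (0 : Fin 4) : E4 →L[ℝ] ℝ).hasFDerivAt.comp_hasDerivAt s hP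
    have hR0 := (Kerr.hasFDerivAt_radius (hSr _ hβS)).comp_hasDerivAt s hP
    have hR : HasDerivAt (fun s => Kerr.radius a (poincareInv Λ c (β s)))
        (Kerr.radiusGrad a (E4.spatial (poincareInv Λ c (β s)))
          (E4.spatial ((Λ : E4 ≃L[ℝ] E4).symm (deriv β s)))) s := hR0
    have hX : mfderiv 𝓘(ℝ, ℝ) 𝓘(ℝ, E4) β s 1 =
        (Λ : E4 ≃L[ℝ] E4) ((Λ : E4 ≃L[ℝ] E4).symm (deriv β s)) := by
      rw [hu, ContinuousLinearEquiv.apply_symm_apply]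
    have hc := hcone (β s) hβS ((Λ : E4 ≃L[ℝ] E4).symm (deriv β s))
      (isFutureDirected_transport 𝓢 rfl (congrArg (mfderiv 𝓘(ℝ, E4) (𝓡 4) ψ (β s)) hX) hfdβ)
    exact ⟨hT, hR, hc.1, hc.2⟩
  have hTmono : MonotoneOn (fun s => poincareInv Λ c (β s) 0) (Icc a' (a' + δ)) :=
    monotoneOn_of_deriv_nonneg (convex_Icc _ _)
      (fun s hs => (hderiv s hs).1.continuousAt.continuousWithinAt)
      (fun s hs => (hderiv s (interior_subset hs)).1.differentiableAt.differentiableWithinAt)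
      fun s hs => by
        rw [(hderiv s (interior_subset hs)).1.deriv]; exact (hderiv s (interior_subset hs)).2.2.1.le
  have hRanti : StrictAntiOn (fun s => Kerr.radius a (poincareInv Λ c (β s))) (Icc a' (a' + δ)) :=
    strictAntiOn_of_deriv_neg (convex_Icc _ _)
      (fun s hs => (hderiv s hs).2.1.continuousAt.continuousWithinAt)
      fun s hs => by
        rw [(hderiv s (interior_subset hs)).2.1.deriv]; exact (hderiv s (interior_subset hs)).2.2.2
  have ha'I : a' ∈ Icc a' (a' + δ) := left_mem_Icc.2 (by linarith)
  have hbI : a' + δ ∈ Icc a' (a' + δ) := right_mem_Icc.2 (by linarith)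
  have hTge : poincareInv Λ c (β a') 0 ≤ poincareInv Λ c (β (a' + δ)) 0 := hTmono ha'I hbI (by linarith)
  have hRlt : Kerr.radius a (poincareInv Λ c (β (a' + δ))) < Kerr.radius a (poincareInv Λ c (β a')) :=
    hRanti ha'I hbI (by linarith)
  rw [hβa] at hTge hRlt
  /- ── (6) the chart point `ζ = β (a' + δ)`: late, `r(ζ) < r₊`, `Φ ζ = γ (a' + δ)`; the tail of `γ` ── -/
  have hζS : β (a' + δ) ∈ S := (hβfacts (a' + δ) hbI).1
  have hζO : β (a' + δ) ∈ (B.domain : Set E4) := hSO hζS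
  have hζt : τ₁ ≤ B.time (β (a' + δ)) := by
    have h1 : B.time w.1 = poincareInv Λ c w.1 0 := hBt w.1
    have h2 : B.time (β (a' + δ)) = poincareInv Λ c (β (a' + δ)) 0 := hBt _
    linarith
  have hζr : B.radius (β (a' + δ)) < rp := by rw [hBr]; linarith
  have hγζ : γ (a' + δ) = Φ ⟨β (a' + δ), hζO⟩ := by
    rw [← hψΦ _ hζO]; exact (heright _ (hI _ hbI).1).symm
  have htail : Φ w' ∈ 𝓢.metric.causalFuture 𝓢.timeOrientation {Φ ⟨β (a' + δ), hζO⟩} :=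
    Or.inr ⟨Φ ⟨β (a' + δ), hζO⟩, Set.mem_singleton _, γ, a' + δ, b', hδ1,
      fun s hs => hγ s ⟨by linarith [hs.1], hs.2⟩, hγζ, hγb⟩
  exact h3b ⟨β (a' + δ), hζO⟩ w' hζt hw'late hζr (by rw [hw'r]) (by rw [hw'r]; linarith) htail

end Chart

end KerrAnchor

end Literature.Geometry.Lorentzian
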